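import Literature.Topology.FourManifolds.SliceDiscZeroFraming
import Literature.Topology.FourManifolds.GluckTwistMeridian
import Literature.AlgebraicTopology.SingularHomology.MayerVietorisExactness
import Literature.AlgebraicTopology.SingularHomology.ExcisionTheorem

/-!
# Helper `helper_friendsCarrier_Vk_partA_partIII_meridian` (piece of the registered stub
`helper_friendsCarrier_Vk_partA_partIII`, line `mk_friends`, skeleton v9) for crux `DcrGap`
(item stmt-SmoothPoincare4-16128, route route-SmoothPoincare4-DottedCircleRasmussen)

**The Mayer–Vietoris skeleton of Part III (the disc framing is the Seifert framing).**  Abstract form: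
`f : ℝ² → ℝ⁴` a disc, `F(x, v) = f x + v₀ m₀ x + v₁ m₁ x` its affine tube on a transversal frame, injective on
`B̄(0, s) × B̄(0, η)` with open image of the open bidisc and a continuous inverse there, `D ⊆ ℝ⁴` a closed set
swallowing the rim `f(|x| = s)`, `Z = ℝ⁴ ∖ (f(B̄(0, s)) ∪ D)`, and a point `f x₀` (`|x₀| < s`) whose closed
flat fibre disc of radius `r₀ < η` misses `D`.  **If the inclusion `ℝ⁴ ∖ D ⊆ ℝ⁴ ∖ R` kills `H₂`**, `R` the rim
circle `u ↦ f (s u)`, then the fibre circle of radius `r₀` over `x₀` has infinite order in `H₁(Z; ℤ)`.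

Proof (Hatcher 2002, §2.2; the tree's `Knot.TubularNbhd.hasFraming_zero_of_tube`, `SliceDiscZeroFraming.lean`):
Mayer–Vietoris for the two open covers `ℝ⁴ ∖ D = Z ∪ T` and `ℝ⁴ ∖ R = (ℝ⁴ ∖ f(B̄)) ∪ T`, `T` the open tube,
and naturality of the connecting maps along the inclusion of triads: if `n • h(μ) = 0` in `H₁(Z)` then
(`h(μ) = 0` in `H₁(T)`, the circle bounds its flat disc) `n • h(μ) = δ σ` for some `σ ∈ H₂(ℝ⁴ ∖ D)`
(`mayerVietoris.exact₃_holds`), hence in the punctured tube of `ℝ⁴ ∖ R` it is `δ (ι⁎ σ) = δ 0 = 0`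
(`mayerVietoris.δ_naturality_holds` and the hypothesis); there the fibre coordinate `F(x, v) ↦ v ∈ ℂ ∖ 0`
maps `μ` to `t ↦ e^{2πit} c₀`, on whose class the winding functional `windH` is `2πi ≠ 0`.

* `helper_friendsCarrier_Vk_partA_partIII_meridian` — the statement above.

No definitions, no named facts, no `sorry`.

## References

* A. Hatcher, *Algebraic Topology*, CUP (2002), §2.2 pp. 149–150, Thm. 2A.1. [HatcherAT2002]
* R. C. Kirby, *The Topology of 4-Manifolds*, LNM 1374 (1989), Ch. I §2. [Kirby1989]
-/

-- the prescribed namespace `Summit.<P>.<Sub>.…` duplicates `SmoothPoincare4` (P = Sub)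
set_option linter.dupNamespace false
set_option linter.style.longLine false

noncomputable section

open scoped Manifold ContDiff Topology
open Set Function Metric Filter Complex CategoryTheory
open Literature.Topology.FourManifolds Literature.Topology.FourManifolds.PlaneComplex
  Literature.AlgebraicTopology.SingularHomology Literature.AlgebraicTopology.SingularHomology.SingularSimplex
  Literature.AlgebraicTopology.FundamentalGroup.PuncturedPlane

namespace Summit.SmoothPoincare4.SmoothPoincare4.Theorems.DcrGap.MkFriends

namespace FriendsCarrierVk

/-- The fibre point `e^{2πit} c₀` read in `ℝ²`. [folklore] -/
theorem norm_ofC_exp_mul (t : ℝ) (c₀ : ℂ) :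
    ‖ofC (exp (((2 * Real.pi * t : ℝ) : ℂ) * I) * c₀)‖ = ‖c₀‖ := by
  rw [← norm_toC (ofC _), toC_ofC, norm_mul, Complex.norm_exp_ofReal_mul_I, one_mul]

/-- **The Mayer–Vietoris skeleton of Part III** (see the module docstring): if `H₂(ℝ⁴ ∖ D) → H₂(ℝ⁴ ∖ R)` is
zero for the rim circle `R` of the disc, then the fibre circle of the affine tube over an interior point whose
closed flat disc misses `D` has infinite order in `H₁(ℝ⁴ ∖ (f(B̄) ∪ D); ℤ)`. [cite: HatcherAT2002, §2.2 p. 149] -/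
theorem meridian_infinite_order_of_core
    (f m₀ m₁ : EuclideanSpace ℝ (Fin 2) → EuclideanSpace ℝ (Fin 4))
    (F : EuclideanSpace ℝ (Fin 2) × EuclideanSpace ℝ (Fin 2) → EuclideanSpace ℝ (Fin 4))
    (Finv : EuclideanSpace ℝ (Fin 4) → EuclideanSpace ℝ (Fin 2) × EuclideanSpace ℝ (Fin 2))
    (Dset Zs : Set (EuclideanSpace ℝ (Fin 4))) (s η r₀ : ℝ) (x₀ : EuclideanSpace ℝ (Fin 2)) (c₀ : ℂ)
    (hF : ∀ q, F q = f q.1 + q.2 0 • m₀ q.1 + q.2 1 • m₁ q.1) (hfc : Continuous f) (hFc : Continuous F)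
    (hs : 0 < s) (hη : 0 < η) (hr₀ : 0 < r₀) (hr₀η : r₀ < η)
    (hinjF : InjOn F (closedBall (0 : EuclideanSpace ℝ (Fin 2)) s ×ˢ closedBall (0 : EuclideanSpace ℝ (Fin 2)) η))
    (hopen : IsOpen (F '' (ball (0 : EuclideanSpace ℝ (Fin 2)) s ×ˢ ball (0 : EuclideanSpace ℝ (Fin 2)) η)))
    (hFinvc : ContinuousOn Finv (F '' (ball (0 : EuclideanSpace ℝ (Fin 2)) s ×ˢ ball (0 : EuclideanSpace ℝ (Fin 2)) η)))
    (hleft : ∀ q ∈ ball (0 : EuclideanSpace ℝ (Fin 2)) s ×ˢ ball (0 : EuclideanSpace ℝ (Fin 2)) η, Finv (F q) = q)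
    (hD : IsClosed Dset) (hrimD : ∀ x : EuclideanSpace ℝ (Fin 2), ‖x‖ = s → f x ∈ Dset)
    (hZs : ∀ y, y ∈ Zs ↔ y ∉ f '' closedBall (0 : EuclideanSpace ℝ (Fin 2)) s ∧ y ∉ Dset)
    (hx₀ : ‖x₀‖ < s) (hdiscD : ∀ v : EuclideanSpace ℝ (Fin 2), ‖v‖ ≤ r₀ → F (x₀, v) ∉ Dset) (hc₀ : ‖c₀‖ = r₀)
    (hcore : ∀ h : Dsetᶜ ⊆ (range fun u : sphere (0 : EuclideanSpace ℝ (Fin 2)) 1 => f (s • (u : EuclideanSpace ℝ (Fin 2))))ᶜ,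
      singularHomology.map ℤ ℤ (subsetInclusion h) 2 = 0) :
    ∀ (p : ↥Zs) (μ : Path p p), (∀ t, ((μ t : ↥Zs) : EuclideanSpace ℝ (Fin 4)) =
        F (x₀, ofC (exp (((2 * Real.pi * t : ℝ) : ℂ) * I) * c₀))) →
      ∀ n : ℤ, n • loopClass ℤ ℤ (1 : ℤ) μ = 0 → n = 0 := by
  intro p μ hμ n hn
  -- the sets
  set A : Set (EuclideanSpace ℝ (Fin 4)) := f '' closedBall (0 : EuclideanSpace ℝ (Fin 2)) s with hA
  set R : Set (EuclideanSpace ℝ (Fin 4)) :=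
    range (fun u : sphere (0 : EuclideanSpace ℝ (Fin 2)) 1 => f (s • (u : EuclideanSpace ℝ (Fin 2)))) with hR
  set T : Set (EuclideanSpace ℝ (Fin 4)) :=
    F '' (ball (0 : EuclideanSpace ℝ (Fin 2)) s ×ˢ ball (0 : EuclideanSpace ℝ (Fin 2)) η) with hT
  have hF0 : ∀ x, F (x, 0) = f x := fun x => by simp [hF]
  have hRD : R ⊆ Dset := by
    rintro _ ⟨u, rfl⟩
    exact hrimD _ (by rw [norm_smul, norm_eq_of_mem_sphere u, mul_one, Real.norm_of_nonneg hs.le])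
  have hsub : Dsetᶜ ⊆ Rᶜ := compl_subset_compl.2 hRD
  have hAc : IsClosed A := ((isCompact_closedBall _ _).image hfc).isClosed
  -- a point `f x`, `‖x‖ ≤ s`, off `D` (resp. off `R`) lies in the open tube
  have hmemT : ∀ x : EuclideanSpace ℝ (Fin 2), ‖x‖ < s → f x ∈ T := fun x hx =>
    ⟨(x, 0), ⟨mem_ball_zero_iff.2 hx, by simpa using hη⟩, hF0 x⟩
  have hAD : ∀ x : EuclideanSpace ℝ (Fin 2), ‖x‖ ≤ s → f x ∉ Dset → ‖x‖ < s := fun x hx hxD =>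
    lt_of_le_of_ne hx fun h => hxD (hrimD x h)
  have hAR : ∀ x : EuclideanSpace ℝ (Fin 2), ‖x‖ ≤ s → f x ∉ R → ‖x‖ < s := by
    intro x hx hxR
    refine lt_of_le_of_ne hx fun h => hxR ?_
    have hx0 : x ≠ 0 := by rintro rfl; rw [norm_zero] at h; exact hs.ne' h.symm
    refine ⟨⟨s⁻¹ • x, by rw [mem_sphere_zero_iff_norm, norm_smul, norm_inv, Real.norm_of_nonneg hs.le, h,
      inv_mul_cancel₀ hs.ne']⟩, ?_⟩
    simp only [smul_smul, mul_inv_cancel₀ hs.ne', one_smul]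
  -- the two ambient types and the four open sets
  let ι : C(↥Dsetᶜ, ↥Rᶜ) := subsetInclusion hsub
  set U₁ : Set ↥Dsetᶜ := Subtype.val ⁻¹' Zs with hU₁
  set V₁ : Set ↥Dsetᶜ := Subtype.val ⁻¹' T with hV₁
  set U₂ : Set ↥Rᶜ := Subtype.val ⁻¹' Aᶜ with hU₂
  set V₂ : Set ↥Rᶜ := Subtype.val ⁻¹' T with hV₂
  have hZso : IsOpen Zs := by
    have : Zs = Aᶜ ∩ Dsetᶜ := Set.ext fun y => by rw [hZs y]; rfl
    rw [this]; exact hAc.isOpen_compl.inter hD.isOpen_compl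
  have hU₁o : IsOpen U₁ := hZso.preimage continuous_subtype_val
  have hV₁o : IsOpen V₁ := hopen.preimage continuous_subtype_val
  have hU₂o : IsOpen U₂ := hAc.isOpen_compl.preimage continuous_subtype_val
  have hV₂o : IsOpen V₂ := hopen.preimage continuous_subtype_val
  have hcov₁ : interior U₁ ∪ interior V₁ = univ := by
    rw [hU₁o.interior_eq, hV₁o.interior_eq]
    refine eq_univ_of_forall fun y => ?_
    by_cases hyA : (y : EuclideanSpace ℝ (Fin 4)) ∈ A
    · obtain ⟨x, hx, hxy⟩ := hyA
      right
      change (y : EuclideanSpace ℝ (Fin 4)) ∈ T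
      rw [← hxy]
      exact hmemT x (hAD x (mem_closedBall_zero_iff.1 hx) (by rw [hxy]; exact y.2))
    · left
      exact (hZs _).2 ⟨hyA, y.2⟩
  have hcov₂ : interior U₂ ∪ interior V₂ = univ := by
    rw [hU₂o.interior_eq, hV₂o.interior_eq]
    refine eq_univ_of_forall fun y => ?_
    by_cases hyA : (y : EuclideanSpace ℝ (Fin 4)) ∈ A
    · obtain ⟨x, hx, hxy⟩ := hyA
      right
      change (y : EuclideanSpace ℝ (Fin 4)) ∈ T
      rw [← hxy]
      exact hmemT x (hAR x (mem_closedBall_zero_iff.1 hx) (by rw [hxy]; exact y.2))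
    · left
      exact hyA
  have hmapU : MapsTo ι U₁ U₂ := fun y hy => ((hZs _).1 hy).1
  have hmapV : MapsTo ι V₁ V₂ := fun y hy => hy
  -- the fibre points of the circle
  set w : ℝ → EuclideanSpace ℝ (Fin 2) := fun t => ofC (exp (((2 * Real.pi * t : ℝ) : ℂ) * I) * c₀) with hw
  have hwn : ∀ t, ‖w t‖ = r₀ := fun t => by rw [hw, norm_ofC_exp_mul, hc₀]
  have hwD : ∀ t, F (x₀, w t) ∉ Dset := fun t => hdiscD _ (hwn t).le
  have hwT : ∀ t, F (x₀, w t) ∈ T := fun t =>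
    ⟨(x₀, w t), ⟨mem_ball_zero_iff.2 hx₀, mem_ball_zero_iff.2 (by rw [hwn]; exact hr₀η)⟩, rfl⟩
  have hvA : ∀ v : EuclideanSpace ℝ (Fin 2), ‖v‖ ≤ η → v ≠ 0 → F (x₀, v) ∉ A := by
    rintro v hv hv0 ⟨x', hx', he⟩
    rw [← hF0] at he
    have := hinjF (mk_mem_prod hx' (by simpa using hη.le))
      (mk_mem_prod (mem_closedBall_zero_iff.2 hx₀.le) (mem_closedBall_zero_iff.2 hv)) he
    exact hv0 (congrArg Prod.snd this).symm
  have hwA : ∀ t, F (x₀, w t) ∉ A := fun t =>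
    hvA _ (by rw [hwn]; exact hr₀η.le) (by rw [← norm_ne_zero_iff, hwn]; exact hr₀.ne')
  have hwZ : ∀ t, F (x₀, w t) ∈ Zs := fun t => (hZs _).2 ⟨hwA t, hwD t⟩
  -- the loop inside `U₁ ∩ V₁`
  have hμmem : ∀ t, (⟨(μ t : EuclideanSpace ℝ (Fin 4)), by rw [hμ t]; exact hwD t⟩ : ↥Dsetᶜ) ∈ U₁ ∩ V₁ :=
    fun t => ⟨by change (μ t : EuclideanSpace ℝ (Fin 4)) ∈ Zs; exact (μ t).2,
      by change (μ t : EuclideanSpace ℝ (Fin 4)) ∈ T; rw [hμ t]; exact hwT t⟩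
  let μ₁ : Path (⟨_, hμmem 0⟩ : ↥(U₁ ∩ V₁)) ⟨_, hμmem 0⟩ :=
    { toFun := fun t => ⟨_, hμmem t⟩
      continuous_toFun := ((continuous_subtype_val.comp μ.continuous).subtype_mk _).subtype_mk _
      source' := rfl
      target' := by
        apply Subtype.ext; apply Subtype.ext
        change ((μ 1 : ↥Zs) : EuclideanSpace ℝ (Fin 4)) = ((μ 0 : ↥Zs) : EuclideanSpace ℝ (Fin 4))
        rw [μ.target, μ.source] }
  -- in `U₁` its class is the image of the class of `μ`, so `n •` it vanishes
  have hleft₁ : n • loopClass ℤ ℤ (1 : ℤ) (μ₁.map (subsetInclusion (inter_subset_left : U₁ ∩ V₁ ⊆ U₁)).continuous) = 0 := by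
    let j : C(↥Zs, ↥U₁) := ⟨fun z => ⟨⟨z.1, ((hZs _).1 z.2).2⟩, z.2⟩, by fun_prop⟩
    have e : ofPath (μ₁.map (subsetInclusion (inter_subset_left : U₁ ∩ V₁ ⊆ U₁)).continuous) =
        ofPath (μ.map j.continuous) := by
      apply toContinuousMap_injective
      ext s' : 1
      rw [ofPath_apply, ofPath_apply]
      rfl
    rw [loopClass_eq_of_ofPath_eq ℤ ℤ 1 _ _ e, ← map_loopClass, ← map_zsmul, hn, map_zero]
  -- in `V₁` the circle bounds its flat disc
  have hright₁ : loopClass ℤ ℤ (1 : ℤ) (μ₁.map (subsetInclusion (inter_subset_right : U₁ ∩ V₁ ⊆ V₁)).continuous) = 0 := by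
    haveI : SimplyConnectedSpace ↥(closedBall (0 : EuclideanSpace ℝ (Fin 2)) r₀) := by
      haveI : ContractibleSpace ↥(closedBall (0 : EuclideanSpace ℝ (Fin 2)) r₀) :=
        Convex.contractibleSpace (convex_closedBall _ _) ⟨0, by simp [hr₀.le]⟩
      infer_instance
    let g : C(↥(closedBall (0 : EuclideanSpace ℝ (Fin 2)) r₀), ↥V₁) :=
      ⟨fun v => ⟨⟨F (x₀, v), hdiscD v (mem_closedBall_zero_iff.1 v.2)⟩,
          show F (x₀, (v : EuclideanSpace ℝ (Fin 2))) ∈ T from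
            ⟨(x₀, v), ⟨mem_ball_zero_iff.2 hx₀, mem_ball_zero_iff.2
              (lt_of_le_of_lt (mem_closedBall_zero_iff.1 v.2) hr₀η)⟩, rfl⟩⟩,
        ((hFc.comp (continuous_const.prodMk continuous_subtype_val)).subtype_mk _).subtype_mk _⟩
    have hwmem : ∀ t : unitInterval, w t ∈ closedBall (0 : EuclideanSpace ℝ (Fin 2)) r₀ := fun t =>
      mem_closedBall_zero_iff.2 (hwn t).le
    have hw01 : w 1 = w 0 := by
      simp only [hw, mul_one, mul_zero, Complex.ofReal_zero, zero_mul, Complex.exp_zero]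
      rw [show ((2 * Real.pi : ℝ) : ℂ) * I = 2 * Real.pi * I by push_cast; ring, Complex.exp_two_pi_mul_I]
    let wl : Path (⟨w 0, hwmem 0⟩ : ↥(closedBall (0 : EuclideanSpace ℝ (Fin 2)) r₀)) ⟨w 0, hwmem 0⟩ :=
      { toFun := fun t => ⟨w t, hwmem t⟩
        continuous_toFun := by
          refine Continuous.subtype_mk ?_ _
          simp only [hw]
          exact continuous_ofC.comp ((Complex.continuous_exp.comp ((Complex.continuous_ofReal.comp
            (continuous_const.mul continuous_subtype_val)).mul continuous_const)).mul continuous_const)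
        source' := rfl
        target' := Subtype.ext hw01 }
    have e : ofPath (μ₁.map (subsetInclusion (inter_subset_right : U₁ ∩ V₁ ⊆ V₁)).continuous) =
        ofPath (wl.map g.continuous) := by
      apply toContinuousMap_injective
      ext s' : 1
      rw [ofPath_apply, ofPath_apply]
      apply Subtype.ext; apply Subtype.ext
      exact hμ _
    have hwl : wl.Homotopic (Path.refl _) := SimplyConnectedSpace.paths_homotopic _ _
    have h2 : (wl.map g.continuous).Homotopic (Path.refl _) := hwl.map g
    rw [loopClass_eq_of_ofPath_eq ℤ ℤ 1 _ _ e, loopClass_eq_of_homotopic ℤ ℤ 1 h2, loopClass_refl]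
  -- Mayer–Vietoris in `ℝ⁴ ∖ D`: `n • h(μ₁) = δ σ`
  have hexc₁ := relativeSingularHomology.isIso_map_of_interior_union_interior_holds ℤ ℤ ↥Dsetᶜ
  have hexc₂ := relativeSingularHomology.isIso_map_of_interior_union_interior_holds ℤ ℤ ↥Rᶜ
  have hφ : mayerVietoris.φ ℤ ℤ U₁ V₁ 1 (n • loopClass ℤ ℤ (1 : ℤ) μ₁) = 0 := by
    refine biprod_apply_ext ?_ ?_
    · rw [LinearMap.map_zero, mayerVietoris.φ, biprod_fst_lift_apply, map_zsmul, map_loopClass]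
      exact hleft₁
    · rw [LinearMap.map_zero, mayerVietoris.φ, biprod_snd_lift_apply]
      change -(singularHomology.map ℤ ℤ (subsetInclusion inter_subset_right) 1 (n • loopClass ℤ ℤ (1 : ℤ) μ₁)) = 0
      rw [map_zsmul, map_loopClass, hright₁, zsmul_zero, neg_zero]
  obtain ⟨σ, hσ⟩ := (ShortComplex.moduleCat_exact_iff _).1
    (mayerVietoris.exact₃_holds ℤ ℤ U₁ V₁ hexc₁ hcov₁ 1) (n • loopClass ℤ ℤ (1 : ℤ) μ₁) hφ
  change mayerVietoris.δ ℤ ℤ U₁ V₁ hexc₁ hcov₁ 1 σ = n • loopClass ℤ ℤ (1 : ℤ) μ₁ at hσ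
  -- naturality along the inclusion of triads and the hypothesis: the class dies in the tube of `ℝ⁴ ∖ R`
  have hnat := mayerVietoris.δ_naturality_holds ℤ ℤ hexc₁ hexc₂ ι hmapU hmapV hcov₁ hcov₂ 1
  have hzero : n • loopClass ℤ ℤ (1 : ℤ) (μ₁.map (subsetRestrict ι (hmapU.inter_inter hmapV)).continuous) = 0 := by
    have h1 : singularHomology.map ℤ ℤ (subsetRestrict ι (hmapU.inter_inter hmapV)) 1
        (mayerVietoris.δ ℤ ℤ U₁ V₁ hexc₁ hcov₁ 1 σ) =
        mayerVietoris.δ ℤ ℤ U₂ V₂ hexc₂ hcov₂ 1 (singularHomology.map ℤ ℤ ι 2 σ) := by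
      rw [← ModuleCat.comp_apply, ← ModuleCat.comp_apply, hnat]
    have h0 : singularHomology.map ℤ ℤ ι 2 σ = 0 := by
      rw [hcore hsub]; rfl
    rw [h0, LinearMap.map_zero, hσ, map_zsmul, map_loopClass] at h1
    exact h1
  -- the fibre coordinate of the punctured tube of `ℝ⁴ ∖ R`
  have hFinvT : ∀ y ∈ T, ∃ q ∈ ball (0 : EuclideanSpace ℝ (Fin 2)) s ×ˢ ball (0 : EuclideanSpace ℝ (Fin 2)) η,
      F q = y ∧ Finv y = q := by
    rintro _ ⟨q, hq, rfl⟩; exact ⟨q, hq, rfl, hleft q hq⟩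
  let fc : C(↥(U₂ ∩ V₂), CStar) :=
    ⟨fun y => ⟨toC (Finv ((y : ↥Rᶜ) : EuclideanSpace ℝ (Fin 4))).2, fun h0 => y.2.1 (by
        obtain ⟨q, hq, hqy, hFq⟩ := hFinvT _ y.2.2
        have hq2 : q.2 = 0 := by
          rw [hFq] at h0
          by_contra hne
          exact toC_ne_zero hne h0
        change ((y : ↥Rᶜ) : EuclideanSpace ℝ (Fin 4)) ∈ A
        rw [← hqy, show q = (q.1, 0) from Prod.ext rfl hq2, hF0]
        exact ⟨q.1, ball_subset_closedBall hq.1, rfl⟩)⟩,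
      (continuous_toC.comp (continuous_snd.comp (hFinvc.comp_continuous
        (continuous_subtype_val.comp continuous_subtype_val) fun y => y.2.2))).subtype_mk _⟩
  have hfcμ : ∀ t, (fc ((μ₁.map (subsetRestrict ι (hmapU.inter_inter hmapV)).continuous) t) : ℂ) =
      exp (((2 * Real.pi * t : ℝ) : ℂ) * I) * c₀ := by
    intro t
    have hμt : ((μ t : ↥Zs) : EuclideanSpace ℝ (Fin 4)) = F (x₀, w t) := hμ t
    have hq : ((x₀, w t) : EuclideanSpace ℝ (Fin 2) × EuclideanSpace ℝ (Fin 2)) ∈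
        ball (0 : EuclideanSpace ℝ (Fin 2)) s ×ˢ ball (0 : EuclideanSpace ℝ (Fin 2)) η :=
      ⟨mem_ball_zero_iff.2 hx₀, mem_ball_zero_iff.2 ((hwn t).trans_lt hr₀η)⟩
    change toC (Finv ((μ t : ↥Zs) : EuclideanSpace ℝ (Fin 4))).2 = _
    rw [hμt, hleft _ hq]
    exact toC_ofC _
  -- the winding functional: `n • 2πi = 0`
  have hc₀0 : c₀ ≠ 0 := by rw [← norm_ne_zero_iff, hc₀]; exact hr₀.ne'
  have hedge : edgeLog (ofPath ((μ₁.map (subsetRestrict ι (hmapU.inter_inter hmapV)).continuous).map fc.continuous)) =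
      2 * Real.pi * I := by
    rw [edgeLog_eq (l := fun t : ℝ => Complex.log c₀ + 2 * Real.pi * t * I) (by fun_prop) fun t ht => ?_]
    · push_cast; ring
    · rw [edgeFun_ofPath _ ht, Complex.exp_add, Complex.exp_log hc₀0]
      change _ = ((fc _ : CStar) : ℂ)
      rw [hfcμ]
      push_cast
      ring_nf
  have h2 := congrArg (fun z => windH (singularHomology.map ℤ ℤ fc 1 z)) hzero
  simp only [map_zsmul, map_loopClass, windH_loopClass, hedge, map_zero] at h2
  have hπ : (2 * Real.pi * I : ℂ) ≠ 0 := by simp [Real.pi_ne_zero, Complex.I_ne_zero]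
  rw [zsmul_eq_mul, mul_eq_zero] at h2
  rcases h2 with h | h
  · exact_mod_cast h
  · exact absurd h hπ

end FriendsCarrierVk

open FriendsCarrierVk in
/-- **Helper `helper_friendsCarrier_Vk_partA_partIII_meridian`** (piece of `helper_friendsCarrier_Vk_partA_partIII`:
the Mayer–Vietoris skeleton — if `H₂(ℝ⁴ ∖ D) → H₂(ℝ⁴ ∖ R)` vanishes for the rim circle `R` of the disc, the fibre
circle of the affine tube over an interior point whose closed flat disc misses `D` has infinite order in
`H₁(ℝ⁴ ∖ (f(B̄) ∪ D); ℤ)`; see the module docstring). [cite: HatcherAT2002, §2.2 p. 149] -/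
theorem helper_friendsCarrier_Vk_partA_partIII_meridian : ∀ (f m₀ m₁ : EuclideanSpace ℝ (Fin 2) → EuclideanSpace ℝ (Fin 4)) (F : EuclideanSpace ℝ (Fin 2) × EuclideanSpace ℝ (Fin 2) → EuclideanSpace ℝ (Fin 4)) (Finv : EuclideanSpace ℝ (Fin 4) → EuclideanSpace ℝ (Fin 2) × EuclideanSpace ℝ (Fin 2)) (Dset Zs : Set (EuclideanSpace ℝ (Fin 4))) (s η r₀ : ℝ) (x₀ : EuclideanSpace ℝ (Fin 2)) (c₀ : ℂ), (∀ q, F q = f q.1 + q.2 0 • m₀ q.1 + q.2 1 • m₁ q.1) → Continuous f → Continuous F → 0 < s → 0 < η → 0 < r₀ → r₀ < η → InjOn F (closedBall (0 : EuclideanSpace ℝ (Fin 2)) s ×ˢ closedBall (0 : EuclideanSpace ℝ (Fin 2)) η) → IsOpen (F '' (ball (0 : EuclideanSpace ℝ (Fin 2)) s ×ˢ ball (0 : EuclideanSpace ℝ (Fin 2)) η)) → ContinuousOn Finv (F '' (ball (0 : EuclideanSpace ℝ (Fin 2)) s ×ˢ ball (0 : EuclideanSpace ℝ (Fin 2)) η))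 → (∀ q ∈ ball (0 : EuclideanSpace ℝ (Fin 2)) s ×ˢ ball (0 : EuclideanSpace ℝ (Fin 2)) η, Finv (F q) = q) → IsClosed Dset → (∀ x : EuclideanSpace ℝ (Fin 2), ‖x‖ = s → f x ∈ Dset) → (∀ y, y ∈ Zs ↔ y ∉ f '' closedBall (0 : EuclideanSpace ℝ (Fin 2)) s ∧ y ∉ Dset) → ‖x₀‖ < s → (∀ v : EuclideanSpace ℝ (Fin 2), ‖v‖ ≤ r₀ → F (x₀, v) ∉ Dset) → ‖c₀‖ = r₀ → (∀ h : Dsetᶜ ⊆ (range fun u : sphere (0 : EuclideanSpace ℝ (Fin 2)) 1 => f (s • (u : EuclideanSpace ℝ (Fin 2))))ᶜ, Literature.AlgebraicTopology.SingularHomology.singularHomology.map ℤ ℤ (Literature.AlgebraicTopology.SingularHomology.subsetInclusion h) 2 = 0) → ∀ (p : ↥Zs) (μ : Path p p), (∀ t, ((μ t : ↥Zs) : EuclideanSpace ℝ (Fin 4)) = F (x₀, PlaneComplex.ofC (Complex.exp (((2 * Real.pi * t : ℝ) : ℂ) * Complex.I) * c₀))) → ∀ n : ℤ, n • Literature.AlgebraicTopology.SingularHomology.loopClass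 ℤ ℤ (1 : ℤ) μ = 0 → n = 0 :=
  fun f m₀ m₁ F Finv Dset Zs s η r₀ x₀ c₀ hF hfc hFc hs hη hr₀ hr₀η hinjF hopen hFinvc hleft hD hrimD hZs hx₀ hdiscD hc₀ hcore =>
    meridian_infinite_order_of_core f m₀ m₁ F Finv Dset Zs s η r₀ x₀ c₀ hF hfc hFc hs hη hr₀ hr₀η hinjF hopen hFinvc hleft hD hrimD hZs hx₀ hdiscD hc₀ hcore

end Summit.SmoothPoincare4.SmoothPoincare4.Theorems.DcrGap.MkFriends

end
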